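import Summits.CriticalPhenomena.PercolationContinuityZ3.Theorems.Transplant.FKConnectivityAllQForestAdjacentNoSqSplit
import Summits.CriticalPhenomena.PercolationContinuityZ3.Theorems.Transplant.FKConnectivityAllQForestAdjacentSliceNoSq
import Summits.CriticalPhenomena.PercolationContinuityZ3.Theorems.Transplant.FKConnectivityAllQEmbedding
import HarnessLib

/-!
# THE LIVE ARROW R_q⁰ ⟹ (♣)⁰: `TwoClusterRayleighGradedNoSqPos → AdjForestRayleighNoSqPos` (square-free q-graded two-cluster Rayleigh
# ⟹ plain coefficientwise forest Rayleigh at every adjacent pair), via transport of fibre counts along `Fin n ↪ Fin (n+1)`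

Support file (`--supports stmt-CriticalPhenomena-4575`), FK sub-lane `prim-bschramm-fk-1` (gen 17) of the post-continuity programme;
builds on p205010 (kernel theorem, internal audit signed; external expert review pending).  No definitions, no named facts, no sorries;
standard axioms.

The pieces: gen 17's `adjForestNoSq_fibre_of_gradedNoSqOn` (`…SliceNoSq`: R_q⁰ on `V` gives the square-free node's inequality on every
split fibre avoiding a SPARE vertex) and `adjForestRayleighNoSqOn_of_split` (`…NoSqSplit`: the node reduces to split fibres).  The spare
vertex is supplied by moving a fibre of `Fin n` into `Fin (n+1)` along `Fin.castSuccEmb`: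
* `fibreCount_eq_of_bij₂` (reindexing across vertex types), **`isForestCfg_image_iff`** (a configuration is a forest iff its image is —
  `|j ω| = |ω|`, and the idle vertices add exactly `|U| − |V|` clusters: `card_connectedComponent_image_eq_add`), **`fibreCount_image`**
  (`#_{(jM, ju)}(A', B') = #_{(M,u)}(A, B)` whenever `A', B'` pull back to `A, B` on image configurations; surjectivity onto the image fibre
  by `eq_image_preimage_of_subset_range`);
* **`adjForestRayleighNoSqOn_of_gradedNoSqOn_succ`**: `TwoClusterRayleighGradedNoSqOn (Fin (n+1)) → AdjForestRayleighNoSqOn (Fin n)`;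
* **`adjForestRayleighNoSqPos_of_gradedNoSqPos : TwoClusterRayleighGradedNoSqPos → AdjForestRayleighNoSqPos`** — the lineage's map now
  reads, in the kernel: R_q⁰ (coefficientwise FK-OSNC in q) ⟹ {CW-OSNC ⟹ OSNC ⟹ EDOM ⟹ CA₂ ⟹ FP2 (p310496)} and ⟹ coefficientwise forest
  Rayleigh at adjacent pairs ⟹ adjacent-edge negative correlation of the arboreal gas at all activities
  (`ag_adjacent_negCorr_of_gradedNoSqPos`; nearest print: Huang 2023 Thm. 2.1, large `β` only).
[cite: SempleWelsh2008, Conj. 1.1 (p. 2)] [cite: CibulkaHladkyLaCroixWagner2008, Thm. 1 (p. 2)] [cite: Grimmett2006, §1.2 eq. (1.1) (p. 4); §1.5 (p. 13)]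
[cite: Linusson2011, Prop. 2.6] [cite: Huang2023ArborealGas, Thm. 2.1 (p. 2)]
-/

noncomputable section

namespace Summit.CriticalPhenomena.PercolationContinuityZ3.Theorems

namespace FK

open MeasureTheory Set Literature.Probability.LatticeModels Literature.Probability.Percolation
open scoped Classical symmDiff

/-! ### Transport of fibre counts along an injection of vertex types -/

section Transport

variable {V U : Type*} [Fintype V] [Fintype U] (j : V ↪ U)

omit [Fintype U] [Fintype V] in
/-- **Reindexing across vertex types**: two fibre counts agree when maps `φ`, `ψ` exchange the counted configurations.
[cite: Linusson2011, Prop. 2.6] -/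
theorem fibreCount_eq_of_bij₂ [Fintype V] [Fintype U] {M u : BondConfig V} {M' u' : BondConfig U} {A B : Set (BondConfig V)}
    {A' B' : Set (BondConfig U)} (φ : BondConfig V → BondConfig U) (ψ : BondConfig U → BondConfig V)
    (h₁ : ∀ ω, ω \ M = u → ω ∈ A → ω ∆ M ∈ B → φ ω \ M' = u' ∧ φ ω ∈ A' ∧ (φ ω) ∆ M' ∈ B' ∧ ψ (φ ω) = ω)
    (h₂ : ∀ ω, ω \ M' = u' → ω ∈ A' → ω ∆ M' ∈ B' → ψ ω \ M = u ∧ ψ ω ∈ A ∧ (ψ ω) ∆ M ∈ B ∧ φ (ψ ω) = ω) :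
    fibreCount M u A B = fibreCount M' u' A' B' := by
  unfold fibreCount
  refine Finset.card_bij' (fun ω _ => φ ω) (fun ω _ => ψ ω) (fun ω hω => ?_) (fun ω hω => ?_) (fun ω hω => ?_) (fun ω hω => ?_)
  · rw [Finset.mem_filter] at hω ⊢
    obtain ⟨h1, h2, h3, -⟩ := h₁ ω hω.2.1 hω.2.2.1 hω.2.2.2
    exact ⟨Finset.mem_univ _, h1, h2, h3⟩
  · rw [Finset.mem_filter] at hω ⊢
    obtain ⟨h1, h2, h3, -⟩ := h₂ ω hω.2.1 hω.2.2.1 hω.2.2.2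
    exact ⟨Finset.mem_univ _, h1, h2, h3⟩
  · rw [Finset.mem_filter] at hω
    exact (h₁ ω hω.2.1 hω.2.2.1 hω.2.2.2).2.2.2
  · rw [Finset.mem_filter] at hω
    exact (h₂ ω hω.2.1 hω.2.2.1 hω.2.2.2).2.2.2

/-- The idle vertices: `#(U ∖ j V) + |V| = |U|`. [folklore] -/
theorem card_idle_add : Nat.card {u : U // u ∉ Set.range j} + Fintype.card V = Fintype.card U := by
  have h1 : (Set.range j).ncard = Nat.card V := by
    rw [← Set.image_univ, Set.ncard_image_of_injective _ j.injective, Set.ncard_univ]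
  have h2 := Set.ncard_add_ncard_compl (Set.range j)
  have h3 : Nat.card {u : U // u ∉ Set.range j} = (Set.range j)ᶜ.ncard := by
    rw [← Nat.card_coe_set_eq]; rfl
  rw [← Nat.card_eq_fintype_card (α := V), ← Nat.card_eq_fintype_card (α := U)]
  omega

/-- **A configuration is a forest iff its image along `j` is** (the idle vertices are isolated clusters).
[cite: Grimmett2006, §1.5 (p. 13); §1.2 eq. (1.1) (p. 4)] -/
theorem isForestCfg_image_iff (ω : BondConfig V) : IsForestCfg (Sym2.map j '' ω) ↔ IsForestCfg ω := by
  rw [isForestCfg_iff_ncard_add, isForestCfg_iff_ncard_add, Set.ncard_image_of_injective _ (Sym2.map.injective j.injective)]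
  have hk : clusterCount (Sym2.map j '' ω) ∅ = clusterCount ω ∅ + Nat.card {u : U // u ∉ Set.range j} := by
    have := card_connectedComponent_image_eq_add j ω ∅
    rw [Set.image_empty] at this
    exact this
  have hU := card_idle_add j
  rw [hk]
  omega

omit [Fintype V] [Fintype U] in
/-- Images of differences. [folklore] -/
theorem image_sdiff_eq (ω M : BondConfig V) : Sym2.map j '' (ω \ M) = Sym2.map j '' ω \ Sym2.map j '' M :=
  Set.image_sdiff (Sym2.map.injective j.injective) _ _

omit [Fintype V] [Fintype U] in
/-- Images of symmetric differences. [folklore] -/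
theorem image_symmDiff_eq (ω M : BondConfig V) : Sym2.map j '' (ω ∆ M) = (Sym2.map j '' ω) ∆ (Sym2.map j '' M) :=
  Set.image_symmDiff (Sym2.map.injective j.injective) _ _

/-- **Transport of fibre counts along `j`**: if the events `A', B'` of `U` pull back to `A, B` on image configurations, then the fibre
count on the image fibre `(j M, j u)` equals the fibre count on `(M, u)`. [cite: Linusson2011, Prop. 2.6] [cite: Grimmett2006, §4.3] -/
theorem fibreCount_image (M u : BondConfig V) {A B : Set (BondConfig V)} {A' B' : Set (BondConfig U)}
    (hA : ∀ ω : BondConfig V, Sym2.map j '' ω ∈ A' ↔ ω ∈ A) (hB : ∀ ω : BondConfig V, Sym2.map j '' ω ∈ B' ↔ ω ∈ B) :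
    fibreCount (Sym2.map j '' M) (Sym2.map j '' u) A' B' = fibreCount M u A B := by
  symm
  refine fibreCount_eq_of_bij₂ (fun ω => Sym2.map j '' ω) (fun ω' => Sym2.map j ⁻¹' ω') (fun ω hω hAω hBω => ?_)
    (fun ω' hω' hA' hB' => ?_)
  · refine ⟨by rw [← image_sdiff_eq, hω], (hA ω).2 hAω, by rw [← image_symmDiff_eq]; exact (hB _).2 hBω, ?_⟩
    exact Set.preimage_image_eq _ (Sym2.map.injective j.injective)
  · have hsub : ω' ⊆ Set.range (Sym2.map j) := by
      intro g hg
      by_cases hgM : g ∈ Sym2.map j '' M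
      · exact mem_range_of_mem_image j hgM
      · have hg' : g ∈ ω' \ Sym2.map j '' M := ⟨hg, hgM⟩
        rw [hω'] at hg'
        exact mem_range_of_mem_image j hg'
    have heq : Sym2.map j '' (Sym2.map j ⁻¹' ω') = ω' := (eq_image_preimage_of_subset_range j hsub).symm
    refine ⟨?_, ?_, ?_, heq⟩
    · apply image_sym2Map_injective j
      show Sym2.map j '' (Sym2.map j ⁻¹' ω' \ M) = Sym2.map j '' u
      rw [image_sdiff_eq, heq, hω']
    · rw [← hA, heq]; exact hA'
    · rw [← hB, image_symmDiff_eq, heq]; exact hB'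

end Transport

/-! ### The arrow -/

/-- **`TwoClusterRayleighGradedNoSqOn (Fin (n+1)) → AdjForestRayleighNoSqOn (Fin n)`**: reduce to split fibres, move the fibre into
`Fin (n+1)` along `Fin.castSuccEmb` (the last vertex is spare), apply the square-free forest slice, and transport back.
[cite: SempleWelsh2008, Conj. 1.1 (p. 2)] [cite: CibulkaHladkyLaCroixWagner2008, Thm. 1 (p. 2)] -/
theorem adjForestRayleighNoSqOn_of_gradedNoSqOn_succ {n : ℕ} (h : TwoClusterRayleighGradedNoSqOn (Fin (n + 1))) :
    AdjForestRayleighNoSqOn (Fin n) := by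
  refine adjForestRayleighNoSqOn_of_split fun M u₀ hd o v y hov hoy hvy heM hfM heu hfu => ?_
  set j : Fin n ↪ Fin (n + 1) := Fin.castSuccEmb with hj
  have hFo : ∀ ω : BondConfig (Fin n), Sym2.map j '' ω ∈ forestEv (Fin (n + 1)) ↔ ω ∈ forestEv (Fin n) :=
    fun ω => isForestCfg_image_iff j ω
  have hmem : ∀ (ω : BondConfig (Fin n)) (a b : Fin n), s(j a, j b) ∈ Sym2.map j '' ω ↔ s(a, b) ∈ ω := by
    intro ω a b; rw [← Sym2.map_mk, map_mem_image_iff]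
  -- transport the two counts to `Fin (n+1)`
  have e1 := fibreCount_image j (insert s(o, y) (insert s(o, v) M)) u₀
    (A := forestEv (Fin n) ∩ {ω | s(o, v) ∈ ω ∧ s(o, y) ∈ ω}) (B := forestEv (Fin n))
    (A' := forestEv (Fin (n + 1)) ∩ {ω | s(j o, j v) ∈ ω ∧ s(j o, j y) ∈ ω}) (B' := forestEv (Fin (n + 1)))
    (fun ω => by rw [mem_inter_iff, mem_inter_iff, hFo, mem_setOf_eq, mem_setOf_eq, hmem, hmem]) hFo
  have e2 := fibreCount_image j (insert s(o, y) (insert s(o, v) M)) u₀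
    (A := forestEv (Fin n) ∩ {ω | s(o, v) ∈ ω}) (B := forestEv (Fin n) ∩ {ω | s(o, y) ∈ ω})
    (A' := forestEv (Fin (n + 1)) ∩ {ω | s(j o, j v) ∈ ω}) (B' := forestEv (Fin (n + 1)) ∩ {ω | s(j o, j y) ∈ ω})
    (fun ω => by rw [mem_inter_iff, mem_inter_iff, hFo, mem_setOf_eq, mem_setOf_eq, hmem])
    (fun ω => by rw [mem_inter_iff, mem_inter_iff, hFo, mem_setOf_eq, mem_setOf_eq, hmem])
  rw [← e1, ← e2, Set.image_insert_eq, Set.image_insert_eq, Sym2.map_mk, Sym2.map_mk]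
  -- the split fibre in `Fin (n+1)` avoids the last vertex
  have hlast : ∀ {x : Fin n}, Fin.last n ≠ j x := fun {x} hx => (Fin.castSucc_lt_last x).ne (by rw [hj] at hx; exact hx.symm)
  have hrange : ∀ g ∈ Sym2.map j '' M ∪ Sym2.map j '' u₀, Fin.last n ∉ g := by
    rintro g hg hlg
    have hg' : g ∈ Set.range (Sym2.map j) := by
      rcases hg with hg | hg <;> exact mem_range_of_mem_image j hg
    obtain ⟨g₀, rfl⟩ := hg'
    obtain ⟨x, -, hx⟩ := Sym2.mem_map.1 hlg
    exact hlast hx.symm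
  have hdj : Disjoint (Sym2.map j '' u₀) (Sym2.map j '' M) :=
    (Set.disjoint_image_iff (Sym2.map.injective j.injective)).2 hd
  exact adjForestNoSq_fibre_of_gradedNoSqOn h hdj (c := Fin.last n) (fun g hg => hrange g (Or.inl hg))
    (fun g hg => hrange g (Or.inr hg)) hlast hlast hlast (fun h' => hov (j.injective h')) (fun h' => hoy (j.injective h'))
    (fun h' => hvy (j.injective h')) (by rw [hmem]; exact heM) (by rw [hmem]; exact hfM)

/-- **`TwoClusterRayleighGradedNoSqPos → AdjForestRayleighNoSqPos`** — R_q⁰ implies plain coefficientwise forest Rayleigh at every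
adjacent pair of every finite graph. [cite: SempleWelsh2008, Conj. 1.1 (p. 2)] [cite: CibulkaHladkyLaCroixWagner2008, Thm. 1 (p. 2)] -/
theorem adjForestRayleighNoSqPos_of_gradedNoSqPos (h : TwoClusterRayleighGradedNoSqPos) : AdjForestRayleighNoSqPos :=
  fun n => adjForestRayleighNoSqOn_of_gradedNoSqOn_succ (h (n + 1))

/-- **R_q⁰ ⟹ adjacent edges of the arboreal gas are negatively correlated, every finite graph, every activity vector**:
`μ(J_e ∩ J_f)·μ(Ω) ≤ μ(J_e)·μ(J_f)` for `μ = agMeasure w` on `Fin n`, `e = ov ≠ f = oy`. [cite: Huang2023ArborealGas, Thm. 2.1 (p. 2)]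
[cite: Grimmett2006, §1.5 eq. (1.22) (p. 13)] [cite: SempleWelsh2008, Conj. 1.1 (p. 2)] -/
theorem ag_adjacent_negCorr_of_gradedNoSqPos (h : TwoClusterRayleighGradedNoSqPos) {n : ℕ} (w : Sym2 (Fin n) → unitInterval)
    {o v y : Fin n} (hvy : v ≠ y) :
    (agMeasure w).real {ω | s(o, v) ∈ ω ∧ s(o, y) ∈ ω} * (agMeasure w).real univ ≤
      (agMeasure w).real {ω | s(o, v) ∈ ω} * (agMeasure w).real {ω | s(o, y) ∈ ω} :=
  ag_adjacent_negCorr_of_adjForestNoSq (adjForestRayleighNoSqPos_of_gradedNoSqPos h n) w hvy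

end FK

end Summit.CriticalPhenomena.PercolationContinuityZ3.Theorems

end
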